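import Mathlib
import HarnessLib
import Literature.MathematicalPhysics.QuantumLattice.HubbardShiftedCovarianceDecomposition
import Summits.HubbardSuperconductivity.HubbardSuperconductivity.Theorems.KLProgrammeKLRegimeWickDressedReorder

/-!
# Route `KLProgramme` — crux K3, ENGINE child (stmt-HubbardSuperconductivity-20236 / gen-7-flow successor), stub `stub_engine_step_values`, conjunct
# (E2-v10)/(E2-F): the DRESSING-DEFECT covariance `E = (D^m + g̃) − D_n` of organisation (R1′) is normal and FIRST ORDER in `sκ`

Cell gate-hubbard-kl, seat hubbard-kl-p1 (g10; (E2) Wick-toolkit lane).  By `klw_kernel_dressedVertex_eq` (p526054) the dressed vertex of the step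
`klw_wickAction_succ_dressed` (p524233) has the kernels of `e^{Δ_E}(𝒲_n − Q)`, `E := (D^m + g̃) − D_n`.  Here `E` is computed: with the soft symbol
`p′` of `D_{n+1}`, the slice symbol `s` of `g_{n+1}`, the two-leg symbol `κ` and `m̂ = (1 + sκ)⁻¹`,

  `E = normalCovariance( −sκm̂ · (p′(1 + m̂) + s) )`                                    (`klw_dressingDefect_eq`)

— ONE explicit self-energy insertion on a (soft or slice) line: relative size `|sκ|`, so the Gram re-Wick-ordering bounds of the tree
(`sum_norm_kernel_gaussConv_le_normV_of_gramBounded`, sectorised `IsGramBoundedR` of normal covariances) make `W̃` an `O(|sκ|)`-perturbation of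
`𝒲_n − Q` degree by degree.  Ingredients: `klw_softCov_eq_normalCovariance` (`D_n` is normal, symbol `(1 − w_n)·βL²G^K₁₁`), `normalCovariance_conj_eq`
(conjugating a normal covariance by a momentum-spin multiplier multiplies the symbol by its square), `normalCovariance_dressingDefect` (symbol algebra).

Exact algebra; nothing about sizes or superconductivity is asserted.  0 kit.
-/

noncomputable section

namespace Summit.HubbardSuperconductivity.HubbardSuperconductivity.Theorems.KLRegimeWick

set_option linter.dupNamespace false -- summit = problem name (single-conjunct summit), D-0017

open Literature.MathematicalPhysics.QuantumLattice GrassmannAlgebra Finset Matrix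
open Literature.Probability.LatticeModels
open Summit.HubbardSuperconductivity.HubbardSuperconductivity.Theorems.KLProgrammeLegKernels
open Summit.HubbardSuperconductivity.HubbardSuperconductivity.Theorems.KLRegimeSplit

/-! ## §1 Pointwise size of the defect symbol (first order in `sκ`) -/

section Pointwise

/-- **The defect symbol is first order in `sκ`**: for `‖sκ‖ ≤ ½`, `‖−sκm̂·(p′(1+m̂) + s)‖ ≤ 2‖sκ‖·(3‖p′‖ + ‖s‖)` (`m̂ = (1+sκ)⁻¹`, `‖m̂‖ ≤ 2`). -/
theorem norm_dressingDefect_symbol_le {p' s κ : ℂ} (h : ‖s * κ‖ ≤ 1 / 2) :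
    ‖-(s * κ * (1 + s * κ)⁻¹) * (p' * (1 + (1 + s * κ)⁻¹) + s)‖ ≤ 2 * ‖s * κ‖ * (3 * ‖p'‖ + ‖s‖) := by
  -- `‖(1+z)⁻¹‖ ≤ 2` for `‖z‖ ≤ ½` (as `Literature.…Loewner.norm_inv_one_add_le`, inlined to keep the import closure inside the Hubbard chain)
  have hm : ‖(1 + s * κ)⁻¹‖ ≤ 2 := by
    have h1 : 1 / 2 ≤ ‖1 + s * κ‖ := by
      have h0 := norm_sub_le (1 + s * κ) (s * κ)
      rw [add_sub_cancel_right, norm_one] at h0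
      linarith
    rw [norm_inv]
    exact (inv_le_comm₀ (lt_of_lt_of_le (by norm_num) h1) two_pos).mpr (by linarith)
  have h2 : ‖p' * (1 + (1 + s * κ)⁻¹) + s‖ ≤ 3 * ‖p'‖ + ‖s‖ := by
    have h3 : ‖1 + (1 + s * κ)⁻¹‖ ≤ 3 := by
      have h4 := norm_add_le (1 : ℂ) (1 + s * κ)⁻¹
      rw [norm_one] at h4
      linarith
    calc ‖p' * (1 + (1 + s * κ)⁻¹) + s‖ ≤ ‖p' * (1 + (1 + s * κ)⁻¹)‖ + ‖s‖ := norm_add_le _ _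
      _ ≤ ‖p'‖ * 3 + ‖s‖ := by rw [norm_mul]; gcongr
      _ = 3 * ‖p'‖ + ‖s‖ := by ring
  rw [norm_mul, norm_neg, norm_mul]
  calc ‖s * κ‖ * ‖(1 + s * κ)⁻¹‖ * ‖p' * (1 + (1 + s * κ)⁻¹) + s‖ ≤ ‖s * κ‖ * 2 * (3 * ‖p'‖ + ‖s‖) := by gcongr
    _ = 2 * ‖s * κ‖ * (3 * ‖p'‖ + ‖s‖) := by ring

end Pointwise

/-! ## §2 Model: the defect covariance in normal form -/

section Model

variable (L M : ℕ) [NeZero L] [NeZero M] (β U μ : ℝ) (K : TrigPolyC4v)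

omit [NeZero M] in
/-- **The soft covariance is normal**: `D_n = C^K − C^K_{>Λ_n} = normalCovariance((1 − w^K_{Λ_n})·βL² G^K₁₁)`. -/
theorem klw_softCov_eq_normalCovariance (n : ℕ) :
    klSoftCov L M β μ K n = normalCovariance L M (fun ks =>
      (1 - (hubbardCutoffWeightCT L M β μ K (klScale klE0 n) ks.1 : ℂ)) *
        (((β * (L : ℝ) ^ 2 : ℝ) : ℂ) * ((Complex.I * matsubaraFreq β M ks.1.1 + nambuXiCT L μ K ks.1.2) / nambuDenCT L M β μ 0 K ks.1))) := by
  rw [klSoftCov, hubbardCovBelowCT, hubbardCovarianceCT_zero_seed, hubbardCovAboveCT_zero_seed, ← normalCovariance_sub_symbol]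
  congr 1
  funext ks
  ring

omit [NeZero L] [NeZero M] in
/-- Conjugating a normal covariance by a multiplier `m` that depends on the momentum-spin label only multiplies the symbol by `m̂²`:
`(m(X)m(Y)·normalCovariance p (X,Y)) = normalCovariance (m̂²p)`. -/
theorem normalCovariance_conj_eq (p : FreqMomentum L M × Fin 2 → ℂ) (m : HubbardFieldIdx L M → ℂ) (mh : FreqMomentum L M × Fin 2 → ℂ)
    (hm : ∀ X, m X = mh X.1) :
    (Matrix.of fun X Y : HubbardFieldIdx L M => m X * m Y * normalCovariance L M p X Y) = normalCovariance L M (fun ks => mh ks ^ 2 * p ks) := by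
  ext X Y
  simp only [Matrix.of_apply, normalCovariance_apply, hm]
  by_cases h : X.1 = Y.1
  · rw [if_pos h, if_pos h, ← h]
    split_ifs <;> ring
  · rw [if_neg h, if_neg h, mul_zero]

omit [NeZero L] [NeZero M] in
/-- **Symbol algebra of the dressing defect**: with `m̂ = (1+sκ)⁻¹`,
`normalCovariance(m̂²p′) + normalCovariance(s/(1+sκ)) − (normalCovariance p′ + normalCovariance s) = normalCovariance(−sκm̂·(p′(1+m̂) + s))`. -/
theorem normalCovariance_dressingDefect (p' s κ : FreqMomentum L M × Fin 2 → ℂ) (hden : ∀ ks, 1 + s ks * κ ks ≠ 0) :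
    normalCovariance L M (fun ks => (1 + s ks * κ ks)⁻¹ ^ 2 * p' ks) + normalCovariance L M (fun ks => s ks / (1 + s ks * κ ks)) -
        (normalCovariance L M p' + normalCovariance L M s) =
      normalCovariance L M (fun ks => -(s ks * κ ks * (1 + s ks * κ ks)⁻¹) * (p' ks * (1 + (1 + s ks * κ ks)⁻¹) + s ks)) := by
  rw [← normalCovariance_add_symbol, ← normalCovariance_add_symbol, ← normalCovariance_sub_symbol]
  congr 1
  funext ks
  have h := hden ks
  field_simp
  ring

omit [NeZero L] [NeZero M] in
/-- **`klw_dressingDefect_eq` — the dressing defect of the dressed Wick step is ONE self-energy insertion.**  In the notation of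
`klw_wickAction_succ_dressed` (`m = (1+sκ)⁻¹` on the momentum-spin label, `g̃ = normalCovariance(s/(1+sκ))`, `D^m = m⊗m·D_{n+1}`), with the soft and slice
covariances in normal form (`klw_softCov_eq_normalCovariance`, `klw_sliceCov_succ_eq_normalCovariance`):
`(D^m + g̃) − D_n = normalCovariance(−sκm̂·(p′(1+m̂) + s))`. -/
theorem klw_dressingDefect_eq (n : ℕ) (p' s κ : FreqMomentum L M × Fin 2 → ℂ) (m : HubbardFieldIdx L M → ℂ)
    (gt Dm : Matrix (HubbardFieldIdx L M) (HubbardFieldIdx L M) ℂ)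
    (hp' : klSoftCov L M β μ K (n + 1) = normalCovariance L M p') (hs : klSliceCov L M β μ K (n + 1) = normalCovariance L M s)
    (hm : m = fun X => (1 + s X.1 * κ X.1)⁻¹)
    (hgt : gt = normalCovariance L M fun ks => s ks / (1 + s ks * κ ks))
    (hDm : Dm = Matrix.of fun X Y => m X * m Y * klSoftCov L M β μ K (n + 1) X Y)
    (hden : ∀ ks : FreqMomentum L M × Fin 2, 1 + s ks * κ ks ≠ 0) :
    Dm + gt - klSoftCov L M β μ K n =
      normalCovariance L M (fun ks => -(s ks * κ ks * (1 + s ks * κ ks)⁻¹) * (p' ks * (1 + (1 + s ks * κ ks)⁻¹) + s ks)) := by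
  rw [klw_softCov_eq_succ_add_slice L M β μ K n, hDm, hp', hs, hgt,
    normalCovariance_conj_eq L M p' m (fun ks => (1 + s ks * κ ks)⁻¹) (fun X => by rw [hm])]
  exact normalCovariance_dressingDefect L M p' s κ hden

end Model

end Summit.HubbardSuperconductivity.HubbardSuperconductivity.Theorems.KLRegimeWick

end
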